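import Literature.NumberTheory.GaloisRepresentations.RestrictFieldSemisimple
import Literature.NumberTheory.Automorphic.LanglandsTetrahedral
import Mathlib.FieldTheory.Galois.Basic
import HarnessLib

/-!
# Cyclic presentation of `Γ_K` modulo `res(Γ_L)` for a cyclic Galois extension `L/K`

Galois glue for the base-change ascent package of the crux `IrreducibleOffSector`
(stmt-Langlands-14329, `Summit.Langlands.Langlands.Theses.IrreducibilityBySelfDuality.IrreducibleOffSector`,
route `Langlands/IrreducibilityBySelfDuality`, line `Sketch`, lead c7, stub W3).

The abstract Clifford dichotomy of that package is stated for a normal subgroup `N ◁ G` with finite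
cyclic quotient, presented by an element `g₀ ∈ G` with `g₀ ^ m ∈ N` such that every `g ∈ G` is
`g₀ ^ i * h` with `h ∈ N`.  This file produces that presentation for `G = Γ_K = Gal(K̄/K)`
(`Field.absoluteGaloisGroup K`), `N = res(Γ_L)` the image of the restriction map
`absGaloisRestrict K L : Γ_L →ₜ* Γ_K` of `Literature/NumberTheory/GaloisRepresentations/AbsGaloisGroup`,
and `m = [L:K]`, for a finite Galois extension `L/K` with cyclic Galois group:

* `Summit.Langlands.Langlands.Theorems.IrreducibleOffSector.exists_cyclic_presentation_absGaloisRestrict`.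

Proof.  Normality is `Literature.NumberTheory.GaloisRepresentations.normal_range_absGaloisRestrict`.
By `Literature.NumberTheory.Automorphic.exists_range_absGaloisRestrict_eq_fixingSubgroup`,
`res(Γ_L) = Gal(K̄/L')` for a subfield `L' ⊆ K̄` that is `K`-isomorphic to `L`; this is the kernel
of the surjective restriction `Γ_K → Gal(L'/K)` (Mathlib `IntermediateField.restrictNormalHom_ker`,
`AlgEquiv.restrictNormalHom_surjective`), and `Gal(L'/K) ≅ Gal(L/K)` (`AlgEquiv.autCongr`) is
cyclic of order `[L:K]` (`IsGalois.card_aut_eq_finrank`).  Take for `g₀` any lift of a generator.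

References: J. S. Milne, *Fields and Galois Theory*, §3 (fundamental theorem) and §7 (infinite
Galois theory); J. Neukirch, *Algebraic Number Theory*, Ch. IV §1.
-/

noncomputable section

-- `Summit.Langlands.Langlands.…` (summit = sub-problem name, D-0017 layout) trips `dupNamespace`
set_option linter.dupNamespace false

open Literature.NumberTheory.GaloisRepresentations Field

namespace Summit.Langlands.Langlands.Theorems.IrreducibleOffSector

/-- **Cyclic presentation of `Γ_K` modulo `res(Γ_L)`.**  For a finite Galois extension `L/K` with
cyclic Galois group, the image `N = res(Γ_L) ≤ Γ_K` of the restriction map `Γ_L → Γ_K` is a normal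
subgroup, and there is `g₀ ∈ Γ_K` (a lift of a generator of `Gal(L/K)`) with `g₀ ^ [L:K] ∈ N` such
that every `g ∈ Γ_K` is of the form `g₀ ^ i * h` with `i : ℕ` and `h ∈ N`.
Ref: Milne, *Fields and Galois Theory*, §3, §7; Neukirch, *Algebraic Number Theory*, Ch. IV §1.
[folklore] -/
theorem exists_cyclic_presentation_absGaloisRestrict (K L : Type*) [Field K] [Field L]
    [Algebra K L] [FiniteDimensional K L] [IsGalois K L] (hcyc : IsCyclic (L ≃ₐ[K] L)) :
    ((absGaloisRestrict K L).range : Subgroup (absoluteGaloisGroup K)).Normal ∧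
    ∃ g₀ : absoluteGaloisGroup K,
      g₀ ^ Module.finrank K L ∈ (absGaloisRestrict K L).range ∧
      ∀ g : absoluteGaloisGroup K, ∃ (i : ℕ) (h : absoluteGaloisGroup K),
        h ∈ (absGaloisRestrict K L).range ∧ g = g₀ ^ i * h := by
  refine ⟨normal_range_absGaloisRestrict K L, ?_⟩
  obtain ⟨L', ⟨e⟩, hrange⟩ :=
    Literature.NumberTheory.Automorphic.exists_range_absGaloisRestrict_eq_fixingSubgroup K L
  haveI : Normal K L' := Normal.of_algEquiv e
  -- `res(Γ_L) = Gal(K̄/L')` is the kernel of the restriction `Γ_K → Gal(L'/K)`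
  have hmem : ∀ g : absoluteGaloisGroup K, g ∈ (absGaloisRestrict K L).range ↔
      AlgEquiv.restrictNormalHom L' (absoluteGaloisGroup.toAlgEquiv K g) = 1 := by
    intro g
    rw [hrange, ← MonoidHom.mem_ker, IntermediateField.restrictNormalHom_ker]
    rfl
  -- `Gal(L'/K) ≅ Gal(L/K)` is cyclic of order `[L:K]`; lift a generator `s` to `g₀ ∈ Γ_K`
  haveI : IsCyclic (L' ≃ₐ[K] L') := e.autCongr.isCyclic.mp hcyc
  haveI : Finite (L' ≃ₐ[K] L') := Finite.of_equiv _ e.autCongr.toEquiv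
  have hcard : Nat.card (L' ≃ₐ[K] L') = Module.finrank K L :=
    (Nat.card_congr e.autCongr.symm.toEquiv).trans (IsGalois.card_aut_eq_finrank K L)
  obtain ⟨s, hs⟩ := IsCyclic.exists_monoid_generator (α := L' ≃ₐ[K] L')
  obtain ⟨g₀, hg₀⟩ := AlgEquiv.restrictNormalHom_surjective (F := K) (AlgebraicClosure K) s
  refine ⟨(absoluteGaloisGroup.toAlgEquiv K).symm g₀, ?_, fun g => ?_⟩
  · rw [hmem]
    simp only [map_pow, MulEquiv.apply_symm_apply, hg₀]
    rw [← hcard, pow_card_eq_one']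
  · obtain ⟨i, hi⟩ := (Submonoid.mem_powers_iff _ _).mp
      (hs (AlgEquiv.restrictNormalHom L' (absoluteGaloisGroup.toAlgEquiv K g)))
    refine ⟨i, ((absoluteGaloisGroup.toAlgEquiv K).symm g₀ ^ i)⁻¹ * g, ?_,
      (mul_inv_cancel_left _ _).symm⟩
    rw [hmem]
    simp only [map_mul, map_inv, map_pow, MulEquiv.apply_symm_apply, hg₀]
    rw [hi, inv_mul_cancel]

end Summit.Langlands.Langlands.Theorems.IrreducibleOffSector

end
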